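import Summits.BirchSwinnertonDyer.BirchSwinnertonDyer.Theorems.ManinLocalTwoThreeAdditiveTwoJBound
import Literature.NumberTheory.DiophantineGeometry.TateAlgorithmThreeTableWalkProofs
import HarnessLib

/-!
# an's S-an-46 `PotOrdinaryAdditiveShapeThree` as a theorem: a potentially ORDINARY additive fibre at `3` is `I₀*` with `9 ∥ N`, `ord₃ Δ_min = 6`;
# additive at `3` ⟹ `ord₃ j + ord₃ Δ_min ≥ 6`

Summit `BirchSwinnertonDyer`, route `ManinLocalTwoThree` (cell bsd-f2-manin), crux C3 `ManinPrimeToThreeAtNine` (stmt-BirchSwinnertonDyer-22968).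
an g25's support row S-an-46 (MEMO-an §67.11, Sketch-an-g25b :31; census 75 066 / 75 066; in print: Serre 1972 §5.6 / Kraus 1990) — here read off the
tree's kernel form of Papadopoulos's Table II / Rizzo's Table II at `p = 3` (`TateAlgorithm.rowDatum_of_minimal`: the 24 rows `(ord c₄, ord c₆, ord Δ)` per
Kodaira type over `ℤ₃`), applied to the integral local minimal model at the place of `3` (`2` a unit, `3` a uniformiser, minimality =
`localMinimalIntegralModel_step11`):

* `six_le_padicValRat_three_j_add_ordMinimalDiscriminant` — additive at `3`, `j ≠ 0` ⟹ `ord₃ j + ord₃ Δ_min ≥ 6` (`ord₃ c₄ ≥ 2` on every additive row);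
* **`potOrdinaryAdditiveShapeThree`** (S-an-46 BY VALUE) — `9 ∣ N`, `j ≠ 0`, `ord₃ j = 0` ⟹ `ord₃ N = 2 ∧ ord₃ Δ_min = 6`: the only row with
  `3·ord c₄ = ord Δ` is `I₀*`'s `(2, 3, 6)`; every other additive row has `ord₃ j ≥ 1` (or `ord₃ j = −n < 0` on `Iₙ*`).

HONEST FRAMING: local structure (a classification-table fact); C3, Manin's conjecture and BSD are not proved.  No definitions, no named facts, no
sorry.  References: [SilvermanATAEC1994] IV.9.4 and Table 4.1; [Papadopoulos1993] Table III (p = 3); [Rizzo2003] Table II; [Kraus1990] Thm 1.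
-/

set_option linter.dupNamespace false
set_option autoImplicit false

noncomputable section

open scoped Classical

open WeierstrassCurve IsDedekindDomain IsLocalRing
  Literature.NumberTheory.DiophantineGeometry Literature.NumberTheory.DiophantineGeometry.TateAlgorithm
  Literature.NumberTheory.EllipticCurves
open IsDiscreteValuationRing hiding maximalIdeal

namespace Summit.BirchSwinnertonDyer.BirchSwinnertonDyer.Theorems.ManinLocalTwoThree

open NumberField Rat.HeightOneSpectrum Summit.BirchSwinnertonDyer.Rank1Residual.Additive

/-- `3` is a uniformiser of `O_v ≃ ℤ₃` at the place `placeOf 3` of `ℤ`. [folklore] -/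
theorem irreducible_three_adicCompletionIntegers_placeOf_three :
    Irreducible (3 : (placeOf 3).adicCompletionIntegers ℚ) := by
  have hgen : natGenerator (placeOf 3) = 3 :=
    congrArg Subtype.val ((primesEquiv (R := ℤ)).apply_symm_apply ⟨3, Nat.prime_three⟩)
  have h := Literature.NumberTheory.DiophantineGeometry.Rat.irreducible_natCast_natGenerator (placeOf 3)
  rw [hgen] at h
  simpa using h

/-- **The `3`-adic class of an additive fibre read off Rizzo's Table II:** for `W/ℚ` additive at `3` with `j ≠ 0`, `ord₃ j + ord₃ Δ_min ≥ 6`, and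
`ord₃ j = 0` exactly on the row `I₀*: (ord c₄, ord c₆, ord Δ) = (2, 3, 6)` — in which case `ord₃ Δ_min = 6` and `f₃ = 2`.
[cite: Rizzo2003, Table II (p. 4)] [cite: Papadopoulos1993, Table III] [cite: SilvermanATAEC1994, IV.9.4 Table 4.1 and IV.11.1] -/
theorem padicValRat_three_j_of_additive (W : WeierstrassCurve ℚ) [W.IsElliptic]
    (hadd : (W.kodairaSymbolAt (placeOf 3)).IsAdditive) (hj : W.j ≠ 0) :
    6 ≤ padicValRat 3 W.j + W.ordMinimalDiscriminant (placeOf 3) ∧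
      (padicValRat 3 W.j = 0 → W.ordMinimalDiscriminant (placeOf 3) = 6 ∧ W.conductorExponent (placeOf 3) = 2) := by
  haveI : Fact (Nat.Prime 3) := ⟨Nat.prime_three⟩
  haveI : PerfectField (IsLocalRing.ResidueField ((placeOf 3).adicCompletionIntegers ℚ)) := PerfectField.ofFinite
  have h3 := irreducible_three_adicCompletionIntegers_placeOf_three
  have h2c : ringChar (ℤ ⧸ (placeOf 3).asIdeal) ≠ 2 := by rw [ringChar_int_quot_placeOf 3]; decide
  have h2 := HeightOneSpectrum.isUnit_two_adicCompletionIntegers ℚ (placeOf 3) h2c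
  set M := W.localMinimalIntegralModel (placeOf 3) with hM
  have hΔ0 : M.Δ ≠ 0 := localMinimalIntegralModel_Δ_ne_zero (placeOf 3) W
  have hc₄0 : M.c₄ ≠ 0 := localMinimalIntegralModel_c₄_ne_zero_of_j_ne_zero (placeOf 3) W hj
  have hδ : W.ordMinimalDiscriminant (placeOf 3) = (addVal ((placeOf 3).adicCompletionIntegers ℚ) M.Δ).toNat := rfl
  have hK : W.kodairaSymbolAt (placeOf 3) = M.kodairaSymbolOfMinimal := kodairaSymbolAt_def (placeOf 3) W
  have hf : W.conductorExponent (placeOf 3) = W.ordMinimalDiscriminant (placeOf 3) + 1 - (W.kodairaSymbolAt (placeOf 3)).numComponents := rfl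
  have hgen : natGenerator (placeOf 3) = 3 := congrArg Subtype.val ((primesEquiv (R := ℤ)).apply_symm_apply ⟨3, Nat.prime_three⟩)
  -- `ord₃ j = 3k − δ` from `ord c₄(M) = k`; `ord₃ j ≥ 3e − δ` from `3^e ∣ c₄(M)`
  have hvj : ∀ k : ℕ, k ≠ 0 → (addVal ((placeOf 3).adicCompletionIntegers ℚ) M.c₄).toNat = k →
      padicValRat 3 W.j = 3 * (k : ℤ) - W.ordMinimalDiscriminant (placeOf 3) := by
    intro k hk hc
    have hval := valuation_j_eq_exp_of_addVal_c₄ (placeOf 3) W hk hc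
    rw [valuation_eq_exp_neg_padicValRat (placeOf 3) hj, hgen] at hval
    have := WithZero.exp_injective hval
    linarith
  have hvj_ge : ∀ e : ℕ, e ≠ 0 → (3 : (placeOf 3).adicCompletionIntegers ℚ) ^ e ∣ M.c₄ →
      3 * (e : ℤ) - W.ordMinimalDiscriminant (placeOf 3) ≤ padicValRat 3 W.j := by
    intro e he hdvd
    have hk := le_addVal_toNat_of_pow_dvd h3 hc₄0 hdvd
    have := hvj _ (by omega) rfl
    rw [this]
    have : (e : ℤ) ≤ (addVal ((placeOf 3).adicCompletionIntegers ℚ) M.c₄).toNat := by exact_mod_cast hk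
    linarith
  have h9 : (9 : (placeOf 3).adicCompletionIntegers ℚ) = 3 ^ 2 := by norm_num
  have h81 : (81 : (placeOf 3).adicCompletionIntegers ℚ) = 3 ^ 4 := by norm_num
  have hrow := rowDatum_of_minimal h2 h3 M hΔ0
    (fun C hu h1 h2 h3 h4 h6 ↦ localMinimalIntegralModel_step11 (placeOf 3) W C hu h1 h2 h3 h4 h6)
  rcases hrow with ⟨hI, -⟩ | ⟨n, hn, hI, -⟩ | ⟨hT, hrows⟩ | ⟨hT, hd, hrows⟩ | ⟨hT, hrows⟩ | ⟨hT, hd, hrows⟩ |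
      ⟨n, hn, hT, hd, hc, -⟩ | ⟨hT, hrows⟩ | ⟨hT, hd, hrows⟩ | ⟨hT, hrows⟩
  · -- good reduction: not additive
    exact absurd (hK ▸ hI : W.kodairaSymbolAt (placeOf 3) = .I 0) hadd.1
  · -- multiplicative: not additive
    exact absurd ⟨n, by omega, (hK ▸ hI : W.kodairaSymbolAt (placeOf 3) = .I n)⟩ hadd.2
  · -- `II`
    rcases hrows with ⟨hd, hc, -⟩ | ⟨hd, hc, -⟩ | ⟨hd, hc, -⟩ | ⟨hd, hc, -⟩
    · have := hvj_ge 2 (by norm_num) (h9 ▸ hc); rw [hδ, hd] at this ⊢; push_cast at this ⊢; exact ⟨by linarith, fun h ↦ by linarith⟩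
    · have := hvj 2 (by norm_num) hc; rw [hδ, hd] at this ⊢; push_cast at this ⊢; exact ⟨by linarith, fun h ↦ by linarith⟩
    · have := hvj 2 (by norm_num) hc; rw [hδ, hd] at this ⊢; push_cast at this ⊢; exact ⟨by linarith, fun h ↦ by linarith⟩
    · have := hvj_ge 3 (by norm_num) hc; rw [hδ, hd] at this ⊢; push_cast at this ⊢; exact ⟨by linarith, fun h ↦ by linarith⟩
  · -- `III`
    rcases hrows with ⟨hc, -⟩ | ⟨hc, -⟩
    · have := hvj_ge 2 (by norm_num) (h9 ▸ hc); rw [hδ, hd] at this ⊢; push_cast at this ⊢; exact ⟨by linarith, fun h ↦ by linarith⟩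
    · have := hvj 2 (by norm_num) hc; rw [hδ, hd] at this ⊢; push_cast at this ⊢; exact ⟨by linarith, fun h ↦ by linarith⟩
  · -- `IV`
    rcases hrows with ⟨hc, -, hd⟩ | ⟨hc, -, hd⟩ | ⟨hc, -, hd⟩
    · have := hvj 2 (by norm_num) hc; rw [hδ, hd] at this ⊢; push_cast at this ⊢; exact ⟨by linarith, fun h ↦ by linarith⟩
    · have := hvj 3 (by norm_num) hc; rw [hδ, hd] at this ⊢; push_cast at this ⊢; exact ⟨by linarith, fun h ↦ by linarith⟩
    · have := hvj_ge 4 (by norm_num) hc; rw [hδ, hd] at this ⊢; push_cast at this ⊢; exact ⟨by linarith, fun h ↦ by linarith⟩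
  · -- `I₀*`: the potentially ordinary row `(2, 3, 6)` and the potentially supersingular row `(3, ≥ 6, 6)`
    rcases hrows with ⟨hc, -⟩ | ⟨hc, -⟩
    · have hv2 := hvj 2 (by norm_num) hc
      have hd' : W.ordMinimalDiscriminant (placeOf 3) = 6 := by rw [hδ, hd]
      rw [hd'] at hv2
      push_cast at hv2
      refine ⟨by rw [hd']; push_cast; linarith, fun _ ↦ ⟨hd', ?_⟩⟩
      rw [hf, hK, hT, KodairaSymbol.numComponents_Istar, hd']
    · have := hvj 3 (by norm_num) hc; rw [hδ, hd] at this ⊢; push_cast at this ⊢; exact ⟨by linarith, fun h ↦ by linarith⟩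
  · -- `Iₙ*`, `n ≥ 1`: `ord₃ j = −n`
    have := hvj 2 (by norm_num) hc
    rw [hδ, ← hd] at this ⊢; push_cast at this ⊢
    exact ⟨by linarith, fun h ↦ by exfalso; linarith⟩
  · -- `IV*`
    rcases hrows with ⟨hc, -, hd, -⟩ | ⟨hc, -, hd⟩ | ⟨hc, -, hd⟩ | ⟨hc, -, hd⟩
    · have := hvj_ge 4 (by norm_num) hc; rw [hδ, hd] at this ⊢; push_cast at this ⊢; exact ⟨by linarith, fun h ↦ by linarith⟩
    · have := hvj 4 (by norm_num) hc; rw [hδ, hd] at this ⊢; push_cast at this ⊢; exact ⟨by linarith, fun h ↦ by linarith⟩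
    · have := hvj 4 (by norm_num) hc; rw [hδ, hd] at this ⊢; push_cast at this ⊢; exact ⟨by linarith, fun h ↦ by linarith⟩
    · have := hvj_ge 5 (by norm_num) hc; rw [hδ, hd] at this ⊢; push_cast at this ⊢; exact ⟨by linarith, fun h ↦ by linarith⟩
  · -- `III*`
    rcases hrows with ⟨hc, -⟩ | ⟨hc, -⟩
    · have := hvj_ge 4 (by norm_num) hc; rw [hδ, hd] at this ⊢; push_cast at this ⊢; exact ⟨by linarith, fun h ↦ by linarith⟩
    · have := hvj 4 (by norm_num) hc; rw [hδ, hd] at this ⊢; push_cast at this ⊢; exact ⟨by linarith, fun h ↦ by linarith⟩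
  · -- `II*`
    rcases hrows with ⟨hc, -, hd⟩ | ⟨hc, -, hd⟩ | ⟨hc, -, hd⟩
    · have := hvj 4 (by norm_num) hc; rw [hδ, hd] at this ⊢; push_cast at this ⊢; exact ⟨by linarith, fun h ↦ by linarith⟩
    · have := hvj 5 (by norm_num) hc; rw [hδ, hd] at this ⊢; push_cast at this ⊢; exact ⟨by linarith, fun h ↦ by linarith⟩
    · have := hvj_ge 6 (by norm_num) hc; rw [hδ, hd] at this ⊢; push_cast at this ⊢; exact ⟨by linarith, fun h ↦ by linarith⟩

/-- **Additive at `3` ⟹ `ord₃ j + ord₃ Δ_min ≥ 6`** (`ord₃ c₄ ≥ 2` on the minimal model). [cite: Rizzo2003, Table II (p. 4)] -/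
theorem six_le_padicValRat_three_j_add_ordMinimalDiscriminant (W : WeierstrassCurve ℚ) [W.IsElliptic]
    (hadd : W.HasAdditiveReductionAt (placeOf 3)) (hj : W.j ≠ 0) :
    6 ≤ padicValRat 3 W.j + W.ordMinimalDiscriminant (placeOf 3) := by
  haveI : PerfectField (IsLocalRing.ResidueField ((placeOf 3).adicCompletionIntegers ℚ)) := PerfectField.ofFinite
  exact (padicValRat_three_j_of_additive W ((isAdditive_kodairaSymbolAt_iff_holds (placeOf 3) W).mpr hadd) hj).1

/-- **S-an-46 `PotOrdinaryAdditiveShapeThree` BY VALUE** (an g25, Sketch-an-g25b :31; in print: Serre 1972 §5.6, Kraus 1990): an additive,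
potentially good, potentially ORDINARY fibre at `3` (`9 ∣ N`, `j ≠ 0`, `ord₃ j = 0`) has `9 ∥ N` and `ord₃ Δ_min = 6` (type `I₀*`).
[cite: Rizzo2003, Table II (p. 4)] [cite: SilvermanATAEC1994, IV.9.4 Table 4.1 and IV.11.1] [cite: Kraus1990] -/
theorem potOrdinaryAdditiveShapeThree (W : WeierstrassCurve ℚ) [W.IsElliptic] [W.IsGloballyMinimal]
    (h9 : 3 ^ 2 ∣ W.conductorNorm ℤ) (hj : W.j ≠ 0) (hv : padicValRat 3 W.j = 0) :
    padicValNat 3 (W.conductorNorm ℤ) = 2 ∧ padicValInt 3 W.minimalDiscriminantInt = 6 := by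
  haveI : Fact (Nat.Prime 3) := ⟨Nat.prime_three⟩
  obtain ⟨-, hadd⟩ := oggComponents_eq_numComponents_of_sq_dvd W 3 h9
  obtain ⟨hd, hf⟩ := (padicValRat_three_j_of_additive W hadd hj).2 hv
  have hδ : W.ordMinimalDiscriminant (placeOf 3) = padicValInt 3 W.minimalDiscriminantInt := ordMinimalDiscriminant_placeOf_eq W 3
  have hfac : (W.conductorNorm ℤ).factorization 3 = W.conductorExponent (placeOf 3) :=
    factorization_conductorNorm_primesEquiv_symm W ⟨3, Nat.prime_three⟩
  refine ⟨by rw [← Nat.factorization_def _ Nat.prime_three, hfac, hf], by rw [← hδ, hd]⟩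

end Summit.BirchSwinnertonDyer.BirchSwinnertonDyer.Theorems.ManinLocalTwoThree

end
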